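import Literature.Combinatorics.Additive.ProductSpaceGlobalHypercontractivity
import Literature.Combinatorics.Additive.ProductSpaceLevelInequality
import HarnessLib

/-!
# The sharp level-`d` inequality for global functions on a product space (KLM §5: Lemma 5.1, Thm 5.2, Thm 5.4), given the hypercontractive estimate

Source: N. Keller, N. Lifshitz, O. Marcus, *Sharp hypercontractivity for global functions*,
arXiv:2307.01356 = J. Eur. Math. Soc. 2026 [KellerLifshitzMarcus2023], §5 (Lemma 5.1, Thm 5.2,
Thm 5.3/5.4), pp. 45–48 of the arXiv version (read first-hand; cell pnp-psdrank, lit g23). Fourth file of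
the programme discharging the tree's named fact `ProductSpace.KellerLifshitzMarcus2023_thm54`
(`ProductSpaceLevelInequality.lean`). Everything here is proved for a GENERAL finite product space with the
uniform measure, modulo ONE explicit hypothesis: the hypercontractive estimate `HcEstimate q ρ g` of
KLM Thm 4.1 (file `ProductSpaceGlobalHypercontractivity.lean`), which `ProductSpaceHypercontractivity.lean`
proves for `[m]^N` by Rademacher encodings; the last theorem `klm_thm54_of_hcEstimate` is then the tree's
fact with that single hypothesis, and `KellerLifshitzMarcus2023_thm54_holds` follows from it.

CONSTANTS (an audit of the printed proof, recorded because the tree's fact carries the printed `2200`):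
KLM prove Lemma 5.1 with `33 = ⌈12e⌉` via Cor 4.7(1)'s rounding `ρ ≥ 1/(6rq)`, Thm 5.2 with
`γ'_d = (33 r/√d)^d γ₁ log^{d/2}(γ₂/γ₁)`, and then Thm 5.4 by Lemma 4.9 (`r ↦ 2r`), which gives
`γ₁² (4356 r² log(γ₂/γ₁)/d)^d` — the printed `2200` is the constant of Thm 5.3, where
`log(1/√γ) = ½ log(1/γ)` supplies an extra factor `½`. The statement with `2200` is nevertheless TRUE and
is what is proved here: Lemma 5.1 is only ever applied (in Thm 5.2) at globalness parameter
`r = (d/log(γ₂/γ₁))^{1/2} = (2/q)^{1/2}`, where Thm 4.5's condition (4.1) admits `ρ̃ = 1/3` for every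
`q ≥ 2` (`klmBeta_third_le`), so Lemma 5.1 holds with `6e (log/d)^{1/2}` in place of `33 (log/d)^{1/2}`
(`l2sq_esLevel_le_of_isL2Global`), Thm 5.2 with `γ'_d = (6e r)^d d^{-d/2} log^{d/2} γ₁`
(`isL2Global_esLevel`), and Thm 5.4 with `144 e² ≤ 1296 ≤ 2200` (`l2sq_esLevel_le_of_isRestrGlobal`).

Also: the dictionary between this programme's expectation normalisation and the tree's counting one on
`[m]^N` (`isRestrGlobal_of_isBiglobalX`, `levelPartX_eq_vecX_esLevel`, `norm_vecX_sq`).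

All proved; no named facts, no instances, no notation; standard axioms. WHAT THIS IS NOT: the encodings /
Thm 4.1 are not here (hypothesis `HcEstimate`); nothing about `S_n`, matchings or psd rank; no P-vs-NP content.
-/

noncomputable section

namespace Literature.Combinatorics.Additive.ProductSpace

open Finset
open scoped InnerProductSpace

variable {ι : Type*} [Fintype ι] [DecidableEq ι] {α : ι → Type*} [∀ i, Fintype (α i)]

/-! ## Hölder tools -/

/-- **Hölder's inequality** for the uniform expectation: `E[f g] ≤ ‖f‖_p ‖g‖_q` for conjugate `p, q`.
[cite: KellerLifshitzMarcus2023, Lemma 5.1 (proof: "by Hölder's inequality we have")] -/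
theorem mean_mul_le_holder [∀ i, Nonempty (α i)] {p q : ℝ} (hpq : p.HolderConjugate q)
    (f g : ((i : ι) → α i) → ℝ) :
    mean (fun x => f x * g x) ≤ lqPow p f ^ (1 / p) * lqPow q g ^ (1 / q) := by
  have hc := cardX_pos (α := α)
  have h := Real.inner_le_Lp_mul_Lq (univ : Finset ((i : ι) → α i)) f g hpq
  have hsum : 1 / p + 1 / q = 1 := by rw [one_div, one_div]; exact hpq.inv_add_inv_eq_one
  unfold mean lqPow ProductSpace.mean
  rw [Real.div_rpow (Finset.sum_nonneg fun x _ => Real.rpow_nonneg (abs_nonneg _) _) hc.le,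
    Real.div_rpow (Finset.sum_nonneg fun x _ => Real.rpow_nonneg (abs_nonneg _) _) hc.le,
    div_mul_div_comm, ← Real.rpow_add hc, hsum, Real.rpow_one]
  exact div_le_div_of_nonneg_right h hc.le

/-- **Log-convexity of the `L^p` norms** between `p = 1` and `p = 2` (Hölder): for `1 < p < 2`,
`E|f|^p ≤ (E|f|)^{2-p} (E f²)^{p-1}`. [cite: KellerLifshitzMarcus2023, Lemma 5.1 (proof: "by the log-convexity of `L^p`-norms we have `‖f‖_{q'} ≤ ‖f‖₁^{1-θ} ‖f‖₂^θ`")] -/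
theorem lqPow_le_l1_l2 [∀ i, Nonempty (α i)] {p : ℝ} (hp1 : 1 < p) (hp2 : p < 2)
    (f : ((i : ι) → α i) → ℝ) :
    lqPow p f ≤ mean (fun x => |f x|) ^ (2 - p) * l2sq f ^ (p - 1) := by
  have hc := cardX_pos (α := α)
  have ha : 0 < 2 - p := by linarith
  have hb : 0 < p - 1 := by linarith
  have hpq : (2 - p)⁻¹.HolderConjugate (p - 1)⁻¹ := Real.HolderConjugate.inv_inv ha hb (by ring)
  have h := Real.inner_le_Lp_mul_Lq_of_nonneg (univ : Finset ((i : ι) → α i)) hpq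
    (f := fun x => |f x| ^ (2 - p)) (g := fun x => |f x| ^ (2 * p - 2))
    (fun x _ => by positivity) (fun x _ => by positivity)
  have e1 : ∀ x : (i : ι) → α i, |f x| ^ (2 - p) * |f x| ^ (2 * p - 2) = |f x| ^ p := by
    intro x
    rw [← Real.rpow_add' (abs_nonneg _) (by linarith)]
    congr 1; ring
  have e2 : ∀ x : (i : ι) → α i, (|f x| ^ (2 - p)) ^ (2 - p)⁻¹ = |f x| := by
    intro x
    rw [← Real.rpow_mul (abs_nonneg _), mul_inv_cancel₀ ha.ne', Real.rpow_one]
  have e3 : ∀ x : (i : ι) → α i, (|f x| ^ (2 * p - 2)) ^ (p - 1)⁻¹ = f x ^ 2 := by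
    intro x
    rw [← Real.rpow_mul (abs_nonneg _), show 2 * p - 2 = 2 * (p - 1) by ring,
      mul_inv_cancel_right₀ hb.ne', Real.rpow_two, sq_abs]
  simp_rw [e1, e2, e3, one_div, inv_inv] at h
  -- divide by `|X| = |X|^{2-p} |X|^{p-1}`
  unfold lqPow l2sq mean
  rw [Real.div_rpow (Finset.sum_nonneg fun x _ => abs_nonneg _) hc.le,
    Real.div_rpow (Finset.sum_nonneg fun x _ => sq_nonneg _) hc.le, div_mul_div_comm,
    ← Real.rpow_add hc, show 2 - p + (p - 1) = 1 by ring, Real.rpow_one]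
  exact div_le_div_of_nonneg_right h hc.le

/-! ## Small facts about derivatives and levels -/

/-- `D_{∅,y} f = f`. [cite: KellerLifshitzMarcus2023, §2.2] -/
theorem deriv_empty [∀ i, Nonempty (α i)] (y : (i : ι) → α i) (f : ((i : ι) → α i) → ℝ) :
    deriv ∅ y f = f := by
  unfold deriv; rw [lap_empty, restr_empty]

omit [Fintype ι] [∀ i, Fintype (α i)] in
/-- `f_{S→y}` depends on `y` only through `y|_S`. [cite: KellerLifshitzMarcus2023, §2.2] -/
theorem restr_congr {S : Finset ι} {y y' : (i : ι) → α i} (h : ∀ i ∈ S, y i = y' i)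
    (f : ((i : ι) → α i) → ℝ) : restr S y f = restr S y' f := by
  funext x
  unfold restr
  congr 1
  funext i
  by_cases hi : i ∈ S <;> simp [Finset.piecewise, hi, h]

/-- `D_{S,y} f` depends on `y` only through `y|_S`. [cite: KellerLifshitzMarcus2023, §2.2] -/
theorem deriv_congr {S : Finset ι} {y y' : (i : ι) → α i} (h : ∀ i ∈ S, y i = y' i)
    (f : ((i : ι) → α i) → ℝ) : deriv S y f = deriv S y' f := by
  unfold deriv; rw [restr_congr h]

/-- `L_S g = 0` if `g` does not depend on some `i ∈ S`. [cite: KellerLifshitzMarcus2023, §2.2] -/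
theorem lap_eq_zero_of_dependsOff [∀ i, Nonempty (α i)] {S : Finset ι} {i : ι} (hi : i ∈ S)
    {g : ((i : ι) → α i) → ℝ} (hg : DependsOff {i} g) : lap S g = fun _ => 0 := by
  rw [← Finset.insert_erase hi, Finset.insert_eq, ← lap_lap, lap_singleton]
  have h1 : (fun x => lap (S.erase i) g x - condAvg {i} (lap (S.erase i) g) x) = fun _ => 0 := by
    funext x
    rw [(dependsOff_lap hg (S.erase i)).condAvg_eq, sub_self]
  rw [h1]

/-- A derivative in a direction the function does not depend on vanishes.
[cite: KellerLifshitzMarcus2023, §2.2] -/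
theorem deriv_eq_zero_of_dependsOff [∀ i, Nonempty (α i)] {S : Finset ι} {i : ι} (hi : i ∈ S)
    {g : ((i : ι) → α i) → ℝ} (hg : DependsOff {i} g) (y : (i : ι) → α i) : deriv S y g = fun _ => 0 := by
  unfold deriv; rw [lap_eq_zero_of_dependsOff hi hg]; rfl

/-- Iterated derivatives with different frozen points: for `i ∉ S`,
`D_{S,y'} D_{i,y} f = D_{S ∪ {i}, z} f` with `z = y` on `i` and `z = y'` elsewhere.
[cite: KellerLifshitzMarcus2023, Thm. 5.2 (proof: "each derivative `D_{S,x}[f^{=d}]` is also a derivative of `D_{i,x}[f^{=d}]`")] -/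
theorem deriv_deriv_singleton [∀ i, Nonempty (α i)] {S : Finset ι} {i : ι} (hi : i ∉ S)
    (y y' : (i : ι) → α i) (f : ((i : ι) → α i) → ℝ) :
    deriv S y' (deriv {i} y f) = deriv (insert i S) (({i} : Finset ι).piecewise y y') f := by
  set z := (({i} : Finset ι).piecewise y y') with hz
  have h1 : deriv S y' (deriv {i} y f) = deriv S z (deriv {i} z f) := by
    rw [deriv_congr (y := y') (y' := z) (fun j hj => by
      have hji : j ≠ i := fun h => hi (h ▸ hj)
      simp [hz, hji])]
    rw [deriv_congr (S := {i}) (y := y) (y' := z) (fun j hj => by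
      rw [Finset.mem_singleton] at hj; subst hj; simp [hz])]
  rw [h1, deriv_deriv (Finset.disjoint_singleton_right.2 hi), Finset.union_comm, ← Finset.insert_eq]

/-- `f^{=0} = E f` (constant). [cite: KellerLifshitzMarcus2023, Thm. 5.2 (proof: "`f^{=0} = E[f]`")] -/
theorem esLevel_zero [∀ i, Nonempty (α i)] (f : ((i : ι) → α i) → ℝ) :
    esLevel 0 f = fun _ => mean f := by
  funext x
  unfold esLevel
  rw [show (univ : Finset (Finset ι)).filter (fun T => T.card = 0) = {∅} by
    ext T; simp [Finset.card_eq_zero]]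
  rw [Finset.sum_singleton]
  unfold esPart
  rw [Finset.powerset_empty, Finset.sum_singleton]
  simp only [Finset.card_empty, add_zero, pow_zero, one_mul, Finset.sdiff_empty]
  unfold condAvg mean
  congr 1
  exact Finset.sum_congr rfl fun y _ => by simp

/-- Derivatives of a constant vanish (`S ≠ ∅`). [cite: KellerLifshitzMarcus2023, §2.2] -/
theorem deriv_const [∀ i, Nonempty (α i)] {S : Finset ι} (hS : S.Nonempty) (y : (i : ι) → α i) (c : ℝ) :
    deriv S y (fun _ : (i : ι) → α i => c) = fun _ => 0 := by
  obtain ⟨i, hi⟩ := hS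
  exact deriv_eq_zero_of_dependsOff hi (fun _ _ _ => rfl) y

/-- `‖const c‖₂² = c²`. [cite: KellerLifshitzMarcus2023, §2.2] -/
theorem l2sq_const [∀ i, Nonempty (α i)] (c : ℝ) : l2sq (fun _ : (i : ι) → α i => c) = c ^ 2 := by
  unfold l2sq; exact mean_const _

/-- `‖0‖₂² = 0`. [cite: KellerLifshitzMarcus2023, §2.2] -/
theorem l2sq_zero [∀ i, Nonempty (α i)] : l2sq (fun _ : (i : ι) → α i => (0 : ℝ)) = 0 := by
  rw [l2sq_const]; ring

/-! ## The numerical facts behind the constants -/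

/-- `1 ≤ log 3 ≤ 2`. [folklore] -/
private theorem log_three_bounds : 1 ≤ Real.log 3 ∧ Real.log 3 ≤ 2 := by
  constructor
  · rw [Real.le_log_iff_exp_le (by norm_num)]
    exact Real.exp_one_lt_three.le
  · rw [Real.log_le_iff_le_exp (by norm_num)]
    have h := Real.exp_one_gt_two
    have : Real.exp 2 = Real.exp 1 * Real.exp 1 := by rw [← Real.exp_add]; norm_num
    nlinarith

/-- **The condition (4.1) at `ρ̃ = 1/3` and `r = (2/q)^{1/2}`**: `β(1/3) = (1 + 2(q-2)/log 3)/3 ≤ q^{1-1/q}`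
for `q ≥ 2` (`log 3 ≥ 1` gives `β ≤ (2q-3)/3`; `q^{-1/q} ≥ 1 - (log q)/q` and `log q ≤ q/3 + 1`, from
`log 3 ≤ 2`, give `q^{1-1/q} ≥ q - log q ≥ (2q-3)/3`). [cite: KellerLifshitzMarcus2023, Cor. 4.7 (proof, condition (4.1))] -/
theorem klmBeta_third_le {q : ℝ} (hq : 2 ≤ q) : klmBeta q (1 / 3) ≤ q ^ (1 - 1 / q) := by
  have hq0 : 0 < q := by linarith
  obtain ⟨hl3, hl3'⟩ := log_three_bounds
  -- upper bound for `β`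
  have hβ : klmBeta q (1 / 3) ≤ (2 * q - 3) / 3 := by
    unfold klmBeta
    rw [one_div_one_div]
    have h1 : 2 * (q - 2) / Real.log 3 ≤ 2 * (q - 2) := by
      rw [div_le_iff₀ (by linarith)]
      nlinarith
    nlinarith
  -- lower bound for `q^{1-1/q} = q · exp(-(log q)/q)`
  have hlogq : Real.log q ≤ q / 3 + 1 := by
    have := Real.log_le_sub_one_of_pos (show 0 < q / 3 by positivity)
    rw [Real.log_div hq0.ne' (by norm_num)] at this
    linarith
  have hpow : q - Real.log q ≤ q ^ (1 - 1 / q) := by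
    have e1 : q ^ (1 - 1 / q) = q * Real.exp (-(Real.log q / q)) := by
      rw [Real.rpow_def_of_pos hq0, show Real.log q * (1 - 1 / q) = Real.log q + -(Real.log q / q) by
        field_simp; ring, Real.exp_add, Real.exp_log hq0]
    rw [e1]
    have e2 : 1 - Real.log q / q ≤ Real.exp (-(Real.log q / q)) := by
      have := Real.add_one_le_exp (-(Real.log q / q)); linarith
    have e3 : q - Real.log q = q * (1 - Real.log q / q) := by field_simp
    rw [e3]
    exact mul_le_mul_of_nonneg_left e2 hq0.le
  linarith

/-- `(1 + 1/d)^d ≤ e`, in the square-root form used for `s_d`: for `d ≥ 1`,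
`(√(Λ/d))^d ≤ 2 (√(Λ/(d+1)))^d` (`Λ ≥ 0`). [folklore] -/
private theorem sqrt_ratio_pow_le {Λ : ℝ} (_hΛ : 0 ≤ Λ) {d : ℕ} (hd : 1 ≤ d) :
    Real.sqrt (Λ / d) ^ d ≤ 2 * Real.sqrt (Λ / (d + 1)) ^ d := by
  have hd0 : (0 : ℝ) < d := by exact_mod_cast hd
  have hsplit : Real.sqrt (Λ / d) = Real.sqrt ((d + 1) / d) * Real.sqrt (Λ / (d + 1)) := by
    rw [← Real.sqrt_mul (by positivity)]
    congr 1
    field_simp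
  rw [hsplit, mul_pow]
  refine mul_le_mul_of_nonneg_right ?_ (by positivity)
  -- `(√((d+1)/d))^d = √(((d+1)/d)^d) ≤ √e ≤ 2`
  have h1 : Real.sqrt ((d + 1) / d) ^ d = Real.sqrt (((d + 1) / (d : ℝ)) ^ d) := by
    rw [Real.sqrt_eq_rpow, Real.sqrt_eq_rpow, ← Real.rpow_natCast, ← Real.rpow_mul (by positivity),
      ← Real.rpow_natCast, ← Real.rpow_mul (by positivity), mul_comm]
  have h2 : ((d + 1) / (d : ℝ)) ^ d ≤ Real.exp 1 := by
    have h3 : (d + 1) / (d : ℝ) ≤ Real.exp (1 / d) := by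
      rw [show (d + 1) / (d : ℝ) = 1 / d + 1 by field_simp; ring]
      exact Real.add_one_le_exp _
    calc ((d + 1) / (d : ℝ)) ^ d ≤ (Real.exp (1 / d)) ^ d := pow_le_pow_left₀ (by positivity) h3 d
      _ = Real.exp 1 := by rw [← Real.exp_nat_mul]; congr 1; field_simp
  rw [h1]
  calc Real.sqrt (((d + 1) / (d : ℝ)) ^ d) ≤ Real.sqrt (Real.exp 1) := Real.sqrt_le_sqrt h2
    _ ≤ Real.sqrt 4 := Real.sqrt_le_sqrt (by linarith [Real.exp_one_lt_three])
    _ = 2 := by rw [show (4 : ℝ) = 2 ^ 2 by norm_num, Real.sqrt_sq (by norm_num)]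

/-! ## KLM Lemma 5.1 (at the globalness parameter where Thm 5.2 uses it, with `ρ̃ = 1/3`) -/

/-- **KLM Lemma 5.1** (sharpened constant, see the module docstring): let `0 < γ₁ < γ₂`,
`Λ = log(γ₂/γ₁)`, `1 ≤ d ≤ Λ/2`, `‖f‖₁ ≤ γ₁`, `‖f‖₂ ≤ γ₂`, and suppose `f^{=d}` is
`((d/Λ)^{1/2}, γ)`-`L²`-global. If the hypercontractive estimate (Thm 4.1) holds for `T_{1/√2} f^{=d}` at
`q = 2Λ/d`, `ρ̃ = 1/3`, then `‖f^{=d}‖₂² ≤ (6e (Λ/d)^{1/2})^d γ₁ γ`. Proof as printed: Hölder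
`‖f^{=d}‖₂² = ⟨f, f^{=d}⟩ ≤ ‖f^{=d}‖_q ‖f‖_{q'}`; `‖f^{=d}‖_q = ρ^{-d} ‖T_ρ f^{=d}‖_q ≤ ρ^{-d} γ` by Thm 4.5
with `ρ = 1/(3√(2q))`; `‖f‖_{q'} ≤ ‖f‖₁^{1-θ} ‖f‖₂^θ ≤ γ₁ e^d` (`θ = 2/q = d/Λ`).
[cite: KellerLifshitzMarcus2023, Lemma 5.1] -/
theorem l2sq_esLevel_le_of_isL2Global [∀ i, Nonempty (α i)] {γ₁ γ₂ γ : ℝ} {d : ℕ} (hd : 1 ≤ d)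
    (hγ₁ : 0 < γ₁) (hγ₁₂ : γ₁ < γ₂) (hγ : 0 < γ) (hdΛ : (d : ℝ) ≤ Real.log (γ₂ / γ₁) / 2)
    (f : ((i : ι) → α i) → ℝ) (hf1 : mean (fun x => |f x|) ≤ γ₁) (hf2 : l2sq f ≤ γ₂ ^ 2)
    (hglob : IsL2Global (Real.sqrt (d / Real.log (γ₂ / γ₁))) γ (esLevel d f))
    (h41 : HcEstimate (2 * Real.log (γ₂ / γ₁) / d) (1 / 3) (noiseOn (1 / Real.sqrt 2) univ (esLevel d f))) :
    l2sq (esLevel d f) ≤ (6 * Real.exp 1 * Real.sqrt (Real.log (γ₂ / γ₁) / d)) ^ d * γ₁ * γ := by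
  set Λ := Real.log (γ₂ / γ₁) with hΛ
  have hγ₂ : 0 < γ₂ := hγ₁.trans hγ₁₂
  have hratio : 1 < γ₂ / γ₁ := by rw [lt_div_iff₀ hγ₁]; linarith
  have hΛpos : 0 < Λ := Real.log_pos hratio
  have hd0 : (0 : ℝ) < d := by exact_mod_cast hd
  set q : ℝ := 2 * Λ / d with hq
  have hq4 : 4 ≤ q := by
    rw [hq, le_div_iff₀ hd0]; linarith
  have hq2 : 2 < q := by linarith
  have hq0 : 0 < q := by linarith
  have hq1 : 1 < q := by linarith
  set L := esLevel d f with hL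
  set s := Real.sqrt (d / Λ) with hs
  have hs0 : 0 < s := Real.sqrt_pos.2 (by positivity)
  -- (a) `‖L‖₂² = E[f L]`
  have ha : l2sq L = mean (fun x => f x * L x) := (mean_mul_esLevel d f).symm
  -- (b) Hölder with `q' = q/(q-1)`, `q`
  set q' : ℝ := q / (q - 1) with hq'
  have hconj : q'.HolderConjugate q := by
    rw [Real.holderConjugate_iff]
    constructor
    · rw [hq', lt_div_iff₀ (by linarith)]; linarith
    · rw [hq']; field_simp; ring
  have hb : mean (fun x => f x * L x) ≤ lqPow q' f ^ (1 / q') * lqPow q L ^ (1 / q) :=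
    mean_mul_le_holder hconj f L
  -- (c) `‖L‖_q ≤ ρ^{-d} γ`, `ρ = (1/3)/√(2q)`
  set ρ : ℝ := (1 / 3) / Real.sqrt (2 * q) with hρ
  have hρ0 : 0 < ρ := by positivity
  have hc : lqPow q L ^ (1 / q) ≤ ρ⁻¹ ^ d * γ := by
    -- `L = ρ^{-d} T_ρ L`
    have heig : noiseOn ρ univ L = fun x => ρ ^ d * L x := by rw [hL, noiseOn_univ_esLevel]
    have hLeq : L = fun x => ρ⁻¹ ^ d * noiseOn ρ univ L x := by
      funext x; rw [heig]; simp only; rw [← mul_assoc, ← mul_pow, inv_mul_cancel₀ hρ0.ne', one_pow, one_mul]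
    -- Thm 4.5 for `L`
    have hβcond : klmBeta q (1 / 3) ≤ Real.sqrt q * (s / Real.sqrt 2) ^ (-(q - 2) / q) := by
      refine (klmBeta_third_le hq2.le).trans (le_of_eq ?_)
      -- `s/√2 = q^{-1/2}` since `s² = d/Λ = 2/q`
      have hs2 : s / Real.sqrt 2 = q ^ (-(1 : ℝ) / 2) := by
        rw [hs, ← Real.sqrt_div' _ (by norm_num : (0 : ℝ) ≤ 2), show (d : ℝ) / Λ / 2 = q⁻¹ by rw [hq]; field_simp,
          Real.sqrt_eq_rpow, ← Real.rpow_neg_one, ← Real.rpow_mul hq0.le]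
        congr 1; ring
      rw [hs2, ← Real.rpow_mul hq0.le, Real.sqrt_eq_rpow, ← Real.rpow_add hq0]
      congr 1; field_simp; ring
    have h45 := lqPow_noiseOn_le_of_isL2Global hq2 hs0 hγ (by norm_num : (0 : ℝ) < 1 / 3)
      (by norm_num : (1 : ℝ) / 3 ≤ 1) hβcond L hglob h41
    -- `l2sq L ≤ γ²` from globalness at `S = ∅`
    have hL2 : l2sq L ≤ γ ^ 2 := by
      have := hglob ∅ (Classical.arbitrary _)
      rw [deriv_empty, Finset.card_empty, pow_zero, one_mul] at this
      exact this
    have hT : lqPow q (noiseOn ρ univ L) ≤ γ ^ q := by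
      refine h45.trans ?_
      calc l2sq L * γ ^ (q - 2) ≤ γ ^ 2 * γ ^ (q - 2) :=
            mul_le_mul_of_nonneg_right hL2 (Real.rpow_nonneg hγ.le _)
        _ = γ ^ q := by
            rw [← Real.rpow_natCast γ 2, ← Real.rpow_add hγ]; congr 1; push_cast; ring
    have hsm : lqPow q L = |ρ⁻¹ ^ d| ^ q * lqPow q (noiseOn ρ univ L) := by
      conv_lhs => rw [hLeq]
      rw [lqPow_smul]
    calc lqPow q L ^ (1 / q) = (|ρ⁻¹ ^ d| ^ q * lqPow q (noiseOn ρ univ L)) ^ (1 / q) := by rw [hsm]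
      _ ≤ (|ρ⁻¹ ^ d| ^ q * γ ^ q) ^ (1 / q) := by
          refine Real.rpow_le_rpow (mul_nonneg (by positivity) (lqPow_nonneg _ _))
            (mul_le_mul_of_nonneg_left hT (by positivity)) (by positivity)
      _ = ρ⁻¹ ^ d * γ := by
          rw [abs_of_pos (by positivity), ← Real.mul_rpow (by positivity) hγ.le, ← Real.rpow_mul (by positivity),
            mul_one_div_cancel hq0.ne', Real.rpow_one]
  -- (d) `‖f‖_{q'} ≤ γ₁ e^d`
  have hd' : lqPow q' f ^ (1 / q') ≤ γ₁ * Real.exp 1 ^ d := by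
    have hq'1 : 1 < q' := hconj.lt
    have hq'2 : q' < 2 := by
      rw [hq', div_lt_iff₀ (by linarith)]; linarith
    have hq'0 : 0 < q' := by linarith
    have h1 := lqPow_le_l1_l2 hq'1 hq'2 f
    have hm : 0 ≤ mean (fun x => |f x|) := mean_nonneg fun x => abs_nonneg _
    have h2 : lqPow q' f ≤ γ₁ ^ (2 - q') * (γ₂ ^ 2) ^ (q' - 1) :=
      h1.trans (mul_le_mul (Real.rpow_le_rpow hm hf1 (by linarith))
        (Real.rpow_le_rpow (l2sq_nonneg f) hf2 (by linarith)) (Real.rpow_nonneg (l2sq_nonneg f) _)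
        (by positivity))
    -- `γ₁^{2-q'} γ₂^{2(q'-1)} = (γ₁ e^d)^{q'}` because `γ₂ = γ₁ e^Λ` and `2Λ(q'-1) = d q'`
    have hdq : (d : ℝ) * q = 2 * Λ := by rw [hq, mul_div_cancel₀ _ hd0.ne']
    have hqq' : q' * (q - 1) = q := by rw [hq', div_mul_cancel₀ _ (by linarith : q - 1 ≠ 0)]
    have hexp : 2 * Λ * (q' - 1) = d * q' := by
      rw [← hdq]; linear_combination (d : ℝ) * hqq'
    have hK : γ₂ = γ₁ * Real.exp Λ := by
      rw [hΛ, Real.exp_log (div_pos hγ₂ hγ₁), mul_div_cancel₀ _ hγ₁.ne']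
    have hEq : γ₁ ^ (2 - q') * (γ₂ ^ 2) ^ (q' - 1) = (γ₁ * Real.exp 1 ^ d) ^ q' := by
      rw [← Real.rpow_natCast γ₂ 2, ← Real.rpow_mul hγ₂.le, hK,
        Real.mul_rpow hγ₁.le (Real.exp_pos _).le, ← Real.exp_mul, ← mul_assoc, ← Real.rpow_add hγ₁,
        Real.mul_rpow hγ₁.le (by positivity), Real.exp_one_pow, ← Real.exp_mul]
      push_cast
      rw [show 2 - q' + 2 * (q' - 1) = q' by ring, show Λ * (2 * (q' - 1)) = (d : ℝ) * q' by linarith]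
    calc lqPow q' f ^ (1 / q') ≤ ((γ₁ * Real.exp 1 ^ d) ^ q') ^ (1 / q') :=
          Real.rpow_le_rpow (lqPow_nonneg _ _) (h2.trans_eq hEq) (by positivity)
      _ = γ₁ * Real.exp 1 ^ d := by
          rw [← Real.rpow_mul (by positivity), mul_one_div_cancel hq'0.ne', Real.rpow_one]
  -- (e) combine
  have hρinv : ρ⁻¹ = 6 * Real.sqrt (Λ / d) := by
    rw [hρ, hq, inv_div, Real.sqrt_eq_rpow, Real.sqrt_eq_rpow,
      show 2 * (2 * Λ / (d : ℝ)) = 4 * (Λ / d) by ring, Real.mul_rpow (by norm_num) (by positivity),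
      show (4 : ℝ) ^ ((1 : ℝ) / 2) = 2 by
        rw [show (4 : ℝ) = 2 ^ (2 : ℝ) by norm_num, ← Real.rpow_mul (by norm_num)]; norm_num]
    ring
  calc l2sq L = mean (fun x => f x * L x) := ha
    _ ≤ lqPow q' f ^ (1 / q') * lqPow q L ^ (1 / q) := hb
    _ ≤ (γ₁ * Real.exp 1 ^ d) * (ρ⁻¹ ^ d * γ) :=
        mul_le_mul hd' hc (Real.rpow_nonneg (lqPow_nonneg _ _) _) (by positivity)
    _ = (6 * Real.exp 1 * Real.sqrt (Λ / d)) ^ d * γ₁ * γ := by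
        rw [hρinv, mul_pow, mul_pow]; ring

/-! ## KLM Theorem 5.2 -/

/-- The parameters of Thm 5.2: `s_d = (d/Λ)^{1/2}` and `γ'_d(γ₁) = (6e r (Λ/d)^{1/2})^d γ₁`
(KLM: `r'_d = √d/log^{1/2}(γ₂/γ₁)`, `γ'_d = (33 r/√d)^d γ₁ log^{d/2}(γ₂/γ₁)` with `33 ↦ 6e`).
[cite: KellerLifshitzMarcus2023, Thm. 5.2] -/
def gammaPrime (r Λ γ₁ : ℝ) (d : ℕ) : ℝ := (6 * Real.exp 1 * r * Real.sqrt (Λ / d)) ^ d * γ₁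

/-- [cite: KellerLifshitzMarcus2023, Thm. 5.2] -/
theorem gammaPrime_pos {r Λ γ₁ : ℝ} (hr : 0 < r) (hΛ : 0 < Λ) (hγ₁ : 0 < γ₁) (d : ℕ) :
    0 < gammaPrime r Λ γ₁ d := by
  unfold gammaPrime
  rcases Nat.eq_zero_or_pos d with rfl | hd
  · simp [hγ₁]
  · have : 0 < Real.sqrt (Λ / d) := Real.sqrt_pos.2 (div_pos hΛ (by exact_mod_cast hd))
    positivity

/-- The recursion inequality of Thm 5.2's induction step:
`γ'_d(r γ₁) ≤ s_{d+1} γ'_{d+1}(γ₁)`, i.e. `((d+1)/d)^{d/2} ≤ 6e`.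
[cite: KellerLifshitzMarcus2023, Thm. 5.2 (proof: "as `γ''_{d-1} ≤ … = r'_d γ'_d`")] -/
theorem gammaPrime_step {r Λ γ₁ : ℝ} (hr : 1 ≤ r) (hΛ : 0 < Λ) (hγ₁ : 0 < γ₁) (d : ℕ) :
    gammaPrime r Λ (r * γ₁) d ≤ Real.sqrt ((d + 1 : ℕ) / Λ) * gammaPrime r Λ γ₁ (d + 1) := by
  unfold gammaPrime
  have hr0 : 0 < r := by linarith
  have he : 2 ≤ 6 * Real.exp 1 := by linarith [Real.exp_one_gt_two]
  have hC : 0 < 6 * Real.exp 1 * r := by positivity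
  push_cast
  have hsq : Real.sqrt ((d + 1) / Λ) * Real.sqrt (Λ / (d + 1)) = 1 := by
    rw [← Real.sqrt_mul (by positivity), show ((d : ℝ) + 1) / Λ * (Λ / (d + 1)) = 1 by field_simp,
      Real.sqrt_one]
  -- reduce to `√(Λ/d)^d ≤ 6e √(Λ/(d+1))^d`
  have key : Real.sqrt (Λ / d) ^ d ≤ 6 * Real.exp 1 * Real.sqrt (Λ / (d + 1)) ^ d := by
    rcases Nat.eq_zero_or_pos d with rfl | hd
    · simp; linarith
    · calc Real.sqrt (Λ / d) ^ d ≤ 2 * Real.sqrt (Λ / (d + 1)) ^ d := sqrt_ratio_pow_le hΛ.le hd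
        _ ≤ 6 * Real.exp 1 * Real.sqrt (Λ / (d + 1)) ^ d := by gcongr
  have hX : 0 < Real.sqrt (Λ / (d + 1)) := Real.sqrt_pos.2 (by positivity)
  have hinv : Real.sqrt ((d + 1) / Λ) = (Real.sqrt (Λ / (d + 1)))⁻¹ := by
    rw [← Real.sqrt_inv, inv_div]
  calc (6 * Real.exp 1 * r * Real.sqrt (Λ / d)) ^ d * (r * γ₁)
      = ((6 * Real.exp 1 * r) ^ d * r * γ₁) * Real.sqrt (Λ / d) ^ d := by rw [mul_pow]; ring
    _ ≤ ((6 * Real.exp 1 * r) ^ d * r * γ₁) * (6 * Real.exp 1 * Real.sqrt (Λ / (d + 1)) ^ d) :=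
        mul_le_mul_of_nonneg_left key (by positivity)
    _ = Real.sqrt ((d + 1) / Λ) * ((6 * Real.exp 1 * r * Real.sqrt (Λ / (d + 1))) ^ (d + 1) * γ₁) := by
        rw [hinv, pow_succ, mul_pow]
        field_simp
        ring

/-- **KLM Theorem 5.2** (with `33 ↦ 6e`), given the hypercontractive estimate: let `r ≥ 1`, `0 < γ₁`,
`1 < K` (`γ₂ = K γ₁`, `Λ = log K`), `d ≤ Λ/2`, and let `f` be `(r, γ₁, d)`-`L¹`-global and
`(r, K γ₁, d)`-`L²`-global (derivative form, Def. 4.8). Then `f^{=d}` is `(s_d, γ'_d)`-`L²`-global with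
`s_d = (d/Λ)^{1/2}`, `γ'_d = (6e r (Λ/d)^{1/2})^d γ₁`; in particular `‖f^{=d}‖₂ ≤ γ'_d`. Induction on `d` as
printed: `D_{i,x}[f^{=d}] = (D_{i,x} f)^{=d-1}` with `D_{i,x} f` `(r, rγ₁, d-1)`/`(r, rKγ₁, d-1)`-global, the
induction hypothesis, `γ''_{d-1} ≤ s_d γ'_d`, and Lemma 5.1 for the norm.
[cite: KellerLifshitzMarcus2023, Thm. 5.2] -/
theorem isL2Global_esLevel [∀ i, Nonempty (α i)] {r K : ℝ} (hr : 1 ≤ r) (hK : 1 < K)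
    (h41 : ∀ (q ρ : ℝ) (g : ((i : ι) → α i) → ℝ), 2 < q → 0 < ρ → ρ ≤ 1 / 3 → HcEstimate q ρ g) :
    ∀ (d : ℕ), (d : ℝ) ≤ Real.log K / 2 → ∀ (γ₁ : ℝ) (f : ((i : ι) → α i) → ℝ), 0 < γ₁ →
      IsL1GlobalD r γ₁ d f → IsL2GlobalD r (K * γ₁) d f →
      IsL2Global (Real.sqrt (d / Real.log K)) (gammaPrime r (Real.log K) γ₁ d) (esLevel d f) := by
  have hΛ : 0 < Real.log K := Real.log_pos hK
  have hr0 : 0 < r := by linarith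
  intro d
  induction d with
  | zero =>
    -- `f^{=0} = E f`, `|E f| ≤ E|f| ≤ γ₁`, derivatives of a constant vanish
    intro _ γ₁ f hγ₁ h1 _ S y
    rw [esLevel_zero]
    rcases S.eq_empty_or_nonempty with rfl | hS
    · rw [deriv_empty, l2sq_const, Finset.card_empty, pow_zero, one_mul]
      unfold gammaPrime
      simp only [pow_zero, one_mul]
      have hm : |mean f| ≤ γ₁ := by
        refine (abs_mean_le_mean_abs f).trans ?_
        have := h1 ∅ (by simp) y
        rw [deriv_empty, Finset.card_empty, pow_zero, one_mul] at this
        exact this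
      exact sq_le_sq' (abs_le.1 hm).1 (abs_le.1 hm).2
    · rw [deriv_const hS, l2sq_zero]
      positivity
  | succ d ih =>
    intro hdΛ γ₁ f hγ₁ h1 h2
    have hdΛ' : (d : ℝ) ≤ Real.log K / 2 := le_trans (by push_cast; linarith) hdΛ
    set L := esLevel (d + 1) f with hL
    set s := Real.sqrt ((d + 1 : ℕ) / Real.log K) with hs
    set γs := gammaPrime r (Real.log K) γ₁ (d + 1) with hγs
    have hγs0 : 0 < γs := gammaPrime_pos hr0 hΛ hγ₁ _
    have hs0 : 0 ≤ s := Real.sqrt_nonneg _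
    -- (b) the bound for non-empty `S`, from the induction hypothesis applied to `D_{i,y} f`
    have hne : ∀ (S : Finset ι) (y : (i : ι) → α i), S.Nonempty → l2sq (deriv S y L) ≤ (s ^ S.card * γs) ^ 2 := by
      intro S y hS
      obtain ⟨i, hi⟩ := hS
      set g := deriv {i} y f with hg
      -- globalness of `g`
      have hg1 : IsL1GlobalD r (r * γ₁) d g := by
        intro S' hS' y'
        by_cases hiS' : i ∈ S'
        · rw [hg, deriv_eq_zero_of_dependsOff hiS' (dependsOff_deriv {i} y f)]
          simp only [abs_zero]
          rw [show (fun _ : (i : ι) → α i => (0 : ℝ)) = fun _ => 0 from rfl, mean_const]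
          positivity
        · rw [hg, deriv_deriv_singleton hiS']
          refine (h1 (insert i S') (by rw [Finset.card_insert_of_notMem hiS']; omega) _).trans (le_of_eq ?_)
          rw [Finset.card_insert_of_notMem hiS', pow_succ]; ring
      have hg2 : IsL2GlobalD r (K * (r * γ₁)) d g := by
        intro S' hS' y'
        by_cases hiS' : i ∈ S'
        · rw [hg, deriv_eq_zero_of_dependsOff hiS' (dependsOff_deriv {i} y f), l2sq_zero]
          positivity
        · rw [hg, deriv_deriv_singleton hiS']
          refine (h2 (insert i S') (by rw [Finset.card_insert_of_notMem hiS']; omega) _).trans (le_of_eq ?_)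
          rw [Finset.card_insert_of_notMem hiS', pow_succ]; ring
      have hIH := ih hdΛ' (r * γ₁) g (by positivity) hg1 hg2
      -- `D_{S,y} L = D_{S∖i, y} (D_{i,y} L)`, `D_{i,y} L = (D_{i,y} f)^{=d}`
      have hsplit : deriv S y L = deriv (S.erase i) y (deriv {i} y L) := by
        rw [deriv_deriv (Finset.disjoint_singleton_right.2 (Finset.notMem_erase i S)), Finset.union_comm,
          ← Finset.insert_eq, Finset.insert_erase hi]
      have hDi : deriv {i} y L = esLevel d g := by rw [hL, hg, deriv_esLevel]
      rw [hsplit, hDi]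
      refine (hIH (S.erase i) y).trans ?_
      -- `s_d^{|S|-1} γ'_d(rγ₁) ≤ s_{d+1}^{|S|} γ'_{d+1}(γ₁)`
      have hcard : (S.erase i).card + 1 = S.card := Finset.card_erase_add_one hi
      have hsd : Real.sqrt (d / Real.log K) ≤ s := by
        rw [hs]; exact Real.sqrt_le_sqrt (by push_cast; gcongr; linarith)
      have hstep := gammaPrime_step hr hΛ hγ₁ d
      have hlhs0 : 0 ≤ Real.sqrt (d / Real.log K) ^ (S.erase i).card * gammaPrime r (Real.log K) (r * γ₁) d :=
        mul_nonneg (pow_nonneg (Real.sqrt_nonneg _) _) (gammaPrime_pos hr0 hΛ (by positivity) d).le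
      refine pow_le_pow_left₀ hlhs0 ?_ 2
      calc Real.sqrt (d / Real.log K) ^ (S.erase i).card * gammaPrime r (Real.log K) (r * γ₁) d
          ≤ s ^ (S.erase i).card * (s * γs) :=
            mul_le_mul (pow_le_pow_left₀ (Real.sqrt_nonneg _) hsd _) hstep
              (gammaPrime_pos hr0 hΛ (by positivity) d).le (pow_nonneg hs0 _)
        _ = s ^ S.card * γs := by rw [← hcard, pow_succ]; ring
    -- (c) the norm bound `‖L‖₂ ≤ γ'_{d+1}` via Lemma 5.1 with `γ̂ = max ‖L‖₂ γ'`
    have hnorm : l2sq L ≤ γs ^ 2 := by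
      set x := l2n L with hx
      have hx0 : 0 ≤ x := Real.sqrt_nonneg _
      have hxsq : l2sq L = x ^ 2 := (Real.sq_sqrt (l2sq_nonneg L)).symm
      set γh := max x γs with hγh
      have hγh0 : 0 < γh := lt_max_of_lt_right hγs0
      have hglob : IsL2Global s γh L := by
        intro S y
        rcases S.eq_empty_or_nonempty with rfl | hS
        · rw [deriv_empty, Finset.card_empty, pow_zero, one_mul, hxsq]
          exact pow_le_pow_left₀ hx0 (le_max_left _ _) 2
        · refine (hne S y hS).trans (pow_le_pow_left₀ (by positivity) ?_ 2)
          exact mul_le_mul_of_nonneg_left (le_max_right _ _) (pow_nonneg hs0 _)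
      -- hypotheses of Lemma 5.1
      have hf1 : mean (fun x => |f x|) ≤ γ₁ := by
        have := h1 ∅ (by simp) (Classical.arbitrary _)
        rwa [deriv_empty, Finset.card_empty, pow_zero, one_mul] at this
      have hf2 : l2sq f ≤ (K * γ₁) ^ 2 := by
        have := h2 ∅ (by simp) (Classical.arbitrary _)
        rwa [deriv_empty, Finset.card_empty, pow_zero, one_mul] at this
      have hKγ : γ₁ < K * γ₁ := by nlinarith
      have hlog : Real.log (K * γ₁ / γ₁) = Real.log K := by rw [mul_div_assoc, div_self hγ₁.ne', mul_one]
      have hq2 : 2 < 2 * Real.log (K * γ₁ / γ₁) / (d + 1 : ℕ) := by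
        rw [hlog, lt_div_iff₀ (by positivity)]
        push_cast at hdΛ ⊢
        nlinarith
      have h51 := l2sq_esLevel_le_of_isL2Global (d := d + 1) (by omega) hγ₁ hKγ hγh0
        (by rw [hlog]; exact hdΛ) f hf1 hf2 (by rw [hlog]; exact hglob)
        (h41 _ _ _ hq2 (by norm_num) le_rfl)
      rw [hlog] at h51
      -- `x² ≤ A γ̂` with `A ≤ γs` (as `r ≥ 1`)
      have hA : (6 * Real.exp 1 * Real.sqrt (Real.log K / (d + 1 : ℕ))) ^ (d + 1) * γ₁ ≤ γs := by
        rw [hγs]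
        unfold gammaPrime
        refine mul_le_mul_of_nonneg_right (pow_le_pow_left₀ (by positivity) ?_ _) hγ₁.le
        have h6 : 0 ≤ 6 * Real.exp 1 * Real.sqrt (Real.log K / (d + 1 : ℕ)) := by positivity
        calc 6 * Real.exp 1 * Real.sqrt (Real.log K / (d + 1 : ℕ))
            = 6 * Real.exp 1 * 1 * Real.sqrt (Real.log K / (d + 1 : ℕ)) := by ring
          _ ≤ 6 * Real.exp 1 * r * Real.sqrt (Real.log K / (d + 1 : ℕ)) := by gcongr
      have hineq : x ^ 2 ≤ γs * γh := by
        rw [← hxsq]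
        refine h51.trans ?_
        exact mul_le_mul_of_nonneg_right hA hγh0.le
      -- conclude `x ≤ γs`
      rw [hxsq]
      refine pow_le_pow_left₀ hx0 ?_ 2
      by_contra hlt
      push Not at hlt
      have hmax : γh = x := max_eq_left hlt.le
      rw [hmax] at hineq
      nlinarith
    -- assemble
    intro S y
    rcases S.eq_empty_or_nonempty with rfl | hS
    · rw [deriv_empty, Finset.card_empty, pow_zero, one_mul]
      exact hnorm
    · exact hne S y hS

/-! ## KLM Theorem 5.4 -/

/-- **KLM Theorem 5.4** (general product space, constant `144e² ≤ 2200`), given the hypercontractive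
estimate for all functions: if `‖f_{S→x}‖₁ ≤ r^{|S|} γ₁` and `‖f_{S→x}‖₂ ≤ r^{|S|} γ₂` for all `|S| ≤ d`, with
`r > 1`, `0 < γ₁ < γ₂`, `d ≤ ½ log(γ₂/γ₁)`, then `‖f^{=d}‖₂² ≤ γ₁² (2200 r² d⁻¹ log(γ₂/γ₁))^d`.
Proof: Lemma 4.9 (`2r`) and Thm 5.2, `(12 e r)² = 144 e² r² ≤ 2200 r²`.
[cite: KellerLifshitzMarcus2023, Thm. 5.4] -/
theorem l2sq_esLevel_le_of_isRestrGlobal [∀ i, Nonempty (α i)]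
    (h41 : ∀ (q ρ : ℝ) (g : ((i : ι) → α i) → ℝ), 2 < q → 0 < ρ → ρ ≤ 1 / 3 → HcEstimate q ρ g)
    {r γ₁ γ₂ : ℝ} {d : ℕ} (hr : 1 < r) (hγ₁ : 0 < γ₁) (hγ₁₂ : γ₁ < γ₂)
    (hd : (d : ℝ) ≤ Real.log (γ₂ / γ₁) / 2) (f : ((i : ι) → α i) → ℝ) (hf : IsRestrGlobal r γ₁ γ₂ d f) :
    l2sq (esLevel d f) ≤ γ₁ ^ 2 * (2200 * r ^ 2 * (1 / (d : ℝ)) * Real.log (γ₂ / γ₁)) ^ d := by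
  have hγ₂ : 0 < γ₂ := hγ₁.trans hγ₁₂
  set K := γ₂ / γ₁ with hK
  have hK1 : 1 < K := by rw [hK, lt_div_iff₀ hγ₁]; linarith
  have hΛ : 0 < Real.log K := Real.log_pos hK1
  have hKγ : K * γ₁ = γ₂ := by rw [hK]; field_simp
  -- Lemma 4.9
  have h1 : IsL1GlobalD (2 * r) γ₁ d f := isL1GlobalD_of_isRestrGlobal hr.le hγ₁.le hf
  have h2 : IsL2GlobalD (2 * r) (K * γ₁) d f := by rw [hKγ]; exact isL2GlobalD_of_isRestrGlobal hr.le hγ₂.le hf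
  -- Thm 5.2 at `S = ∅`
  have h52 := isL2Global_esLevel (by linarith : (1 : ℝ) ≤ 2 * r) hK1 h41 d hd γ₁ f hγ₁ h1 h2 ∅
    (Classical.arbitrary _)
  rw [deriv_empty, Finset.card_empty, pow_zero, one_mul] at h52
  refine h52.trans ?_
  -- `γ'_d(2r)² = γ₁² (144 e² r² Λ/d)^d ≤ γ₁² (2200 r² Λ/d)^d`
  unfold gammaPrime
  rw [mul_pow, ← pow_mul, mul_comm d 2, pow_mul]
  rw [mul_comm (_ ^ d) (γ₁ ^ 2)]
  refine mul_le_mul_of_nonneg_left (pow_le_pow_left₀ (sq_nonneg _) ?_ d) (sq_nonneg _)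
  rcases Nat.eq_zero_or_pos d with rfl | hdpos
  · -- `d = 0`: both sides are degenerate but the inequality `(12 e r · √(Λ/0))² ≤ 2200 r² (1/0) Λ` reads `0 ≤ 0`
    simp
  have hd0 : (0 : ℝ) < d := by exact_mod_cast hdpos
  have hsq : Real.sqrt (Real.log K / d) ^ 2 = Real.log K / d := Real.sq_sqrt (by positivity)
  have he : Real.exp 1 ^ 2 ≤ 9 := by nlinarith [Real.exp_one_lt_three, Real.exp_pos 1]
  calc (6 * Real.exp 1 * (2 * r) * Real.sqrt (Real.log K / d)) ^ 2
      = 144 * Real.exp 1 ^ 2 * r ^ 2 * (Real.log K / d) := by rw [mul_pow, mul_pow, mul_pow, hsq]; ring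
    _ ≤ 144 * 9 * r ^ 2 * (Real.log K / d) := by gcongr
    _ ≤ 2200 * r ^ 2 * (1 / (d : ℝ)) * Real.log K := by
        rw [show 2200 * r ^ 2 * (1 / (d : ℝ)) * Real.log K = 2200 * r ^ 2 * (Real.log K / d) by ring]
        gcongr
        norm_num

/-! ## The dictionary with the tree's counting normalisation on `[m]^N` -/

section Cube

variable {N m : ℕ}

/-- `|[m]^N| = m^N`. [cite: KeevashLifshitz2023, §1.4] -/
theorem cardX_fin : cardX (fun _ : Fin N => Fin m) = (m : ℝ) ^ N := by
  unfold cardX; simp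

/-- `‖vecX g‖² = ∑_x g(x)² = m^N ‖g‖₂²`. [cite: KeevashLifshitz2023, §1.4 (expectation vs counting norms)] -/
theorem norm_vecX_sq [Nonempty (Fin m)] (g : (Fin N → Fin m) → ℝ) :
    ‖vecX g‖ ^ 2 = (m : ℝ) ^ N * l2sq (α := fun _ : Fin N => Fin m) g := by
  have hmN : (0 : ℝ) < (m : ℝ) ^ N := by
    rw [← cardX_fin]; exact cardX_pos (α := fun _ : Fin N => Fin m)
  rw [norm_sq_eq_sum]
  unfold l2sq mean
  rw [cardX_fin, mul_div_cancel₀ _ hmN.ne']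
  simp only [vecX_apply]

/-- Points of a cylinder on `Sᶜ`: those agreeing with `z` off `S`; there are `m^{|S|}` of them.
[cite: KeevashLifshitz2023, §1.4 (cylinders / `d`-juntas)] -/
theorem card_filter_agree_off (S : Finset (Fin N)) (z : Fin N → Fin m) :
    ((univ : Finset (Fin N → Fin m)).filter (fun x => ∀ i, i ∉ S → x i = z i)).card = m ^ S.card := by
  classical
  -- `{x : x = z off S} ≃ (S → Fin m)`
  let e : {x : Fin N → Fin m // ∀ i, i ∉ S → x i = z i} ≃ (S → Fin m) :=
    { toFun := fun x i => x.1 i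
      invFun := fun g => ⟨fun i => if h : i ∈ S then g ⟨i, h⟩ else z i, fun i hi => by simp [hi]⟩
      left_inv := fun x => by
        ext i
        by_cases hi : i ∈ S
        · simp [hi]
        · simp [hi, x.2 i hi]
      right_inv := fun g => by
        funext i
        simp [i.2] }
  rw [← Fintype.card_subtype, Fintype.card_congr e, Fintype.card_fun, Fintype.card_fin, Fintype.card_coe]

/-- **Restriction sums vs cylinder sums**: `∑_x Φ(S.piecewise y x) = m^{|S|} ∑_{z ∈ cylinder S y} Φ(z)`.
[cite: KeevashLifshitz2023, §1.4] -/
theorem sum_piecewise_eq_mul_sum_cylinder (S : Finset (Fin N)) (y : Fin N → Fin m)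
    (Φ : (Fin N → Fin m) → ℝ) :
    ∑ x : Fin N → Fin m, Φ (S.piecewise y x) = (m : ℝ) ^ S.card * ∑ z ∈ cylinder S y, Φ z := by
  classical
  rw [Finset.sum_comp (s := (univ : Finset (Fin N → Fin m))) (f := Φ) (g := fun x => S.piecewise y x)]
  have himg : (univ : Finset (Fin N → Fin m)).image (fun x => S.piecewise y x) = cylinder S y := by
    ext z
    simp only [Finset.mem_image, Finset.mem_univ, true_and, mem_cylinder]
    constructor
    · rintro ⟨x, rfl⟩ i hi
      simp [Finset.piecewise, hi]
    · intro hz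
      refine ⟨z, ?_⟩
      funext i
      by_cases hi : i ∈ S <;> simp [Finset.piecewise, hi, hz]
  rw [himg, Finset.mul_sum]
  refine Finset.sum_congr rfl fun z hz => ?_
  rw [mem_cylinder] at hz
  have hfib : (univ : Finset (Fin N → Fin m)).filter (fun x => S.piecewise y x = z) =
      (univ : Finset (Fin N → Fin m)).filter (fun x => ∀ i, i ∉ S → x i = z i) := by
    ext x
    simp only [Finset.mem_filter, Finset.mem_univ, true_and]
    constructor
    · intro h i hi
      have := congrFun h i
      simpa [Finset.piecewise, hi] using this
    · intro h
      funext i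
      by_cases hi : i ∈ S
      · simp [Finset.piecewise, hi, hz i hi]
      · simp [Finset.piecewise, hi, h i hi]
  rw [hfib, card_filter_agree_off, nsmul_eq_mul]
  push_cast
  ring

/-- **The tree's biglobalness is this programme's restriction-globalness** (same statement, counting vs
expectation normalisation). [cite: KeevashLifshitz2023, Def. 1.4] -/
theorem isRestrGlobal_of_isBiglobalX [Nonempty (Fin m)] {r γ₁ γ₂ : ℝ} {d : ℕ}
    {h : (Fin N → Fin m) → ℝ}
    (hh : IsBiglobalX r γ₁ γ₂ d h) : IsRestrGlobal (α := fun _ : Fin N => Fin m) r γ₁ γ₂ d h := by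
  intro S hS y
  have hmN : (0 : ℝ) < (m : ℝ) ^ N := by
    rw [← cardX_fin]; exact cardX_pos (α := fun _ : Fin N => Fin m)
  have hSN : S.card ≤ N := by simpa using S.card_le_univ
  have hpow : (m : ℝ) ^ S.card * (m : ℝ) ^ (N - S.card) = (m : ℝ) ^ N := by
    rw [← pow_add, Nat.add_sub_cancel' hSN]
  obtain ⟨h1, h2⟩ := hh S hS y
  constructor
  · unfold mean restr
    rw [cardX_fin, div_le_iff₀ hmN, sum_piecewise_eq_mul_sum_cylinder S y (fun x => |h x|)]
    calc (m : ℝ) ^ S.card * ∑ z ∈ cylinder S y, |h z|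
        ≤ (m : ℝ) ^ S.card * (r ^ S.card * γ₁ * (m : ℝ) ^ (N - S.card)) :=
          mul_le_mul_of_nonneg_left h1 (by positivity)
      _ = r ^ S.card * γ₁ * (m : ℝ) ^ N := by rw [← hpow]; ring
  · unfold l2sq mean restr
    rw [cardX_fin, div_le_iff₀ hmN, sum_piecewise_eq_mul_sum_cylinder S y (fun x => h x ^ 2)]
    calc (m : ℝ) ^ S.card * ∑ z ∈ cylinder S y, h z ^ 2
        ≤ (m : ℝ) ^ S.card * ((r ^ S.card * γ₂) ^ 2 * (m : ℝ) ^ (N - S.card)) :=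
          mul_le_mul_of_nonneg_left h2 (by positivity)
      _ = (r ^ S.card * γ₂) ^ 2 * (m : ℝ) ^ N := by rw [← hpow]; ring

/-- A part `h^{=T}` with `T ⊄ S` is orthogonal to the indicator of any cylinder on `S`.
[cite: KeevashLifshitz2023, §1.4 (`V_{≤d}` and its orthogonal complement)] -/
theorem inner_vecX_esPart_indX_cylinder [Nonempty (Fin m)] {T S : Finset (Fin N)} (hTS : ¬ T ⊆ S)
    (h : (Fin N → Fin m) → ℝ) (y : Fin N → Fin m) :
    ⟪vecX (esPart (α := fun _ : Fin N => Fin m) T h), indX (cylinder S y)⟫_ℝ = 0 := by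
  obtain ⟨i, hiT, hiS⟩ : ∃ i ∈ T, i ∉ S := by
    by_contra hc; push Not at hc; exact hTS fun j hj => hc j hj
  rw [inner_eq_sum]
  -- the indicator does not depend on `i`; `E_i h^{=T} = 0`; self-adjointness of `E_i`
  set g : (Fin N → Fin m) → ℝ := fun x => if x ∈ cylinder S y then 1 else 0 with hg
  have hgi : DependsOff (α := fun _ : Fin N => Fin m) {i} g := by
    intro x x' hxx'
    have hiff : x ∈ cylinder S y ↔ x' ∈ cylinder S y := by
      rw [mem_cylinder, mem_cylinder]
      constructor
      · intro hx j hj; rw [← hxx' j (by rw [Finset.mem_singleton]; exact fun h => hiS (h ▸ hj))]; exact hx j hj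
      · intro hx j hj; rw [hxx' j (by rw [Finset.mem_singleton]; exact fun h => hiS (h ▸ hj))]; exact hx j hj
    simp only [hg, hiff]
  have hsum : ∑ x : Fin N → Fin m, vecX (esPart (α := fun _ : Fin N => Fin m) T h) x * indX (cylinder S y) x =
      ∑ x : Fin N → Fin m, g x * esPart (α := fun _ : Fin N => Fin m) T h x := by
    refine Finset.sum_congr rfl fun x _ => ?_
    simp only [vecX_apply, indX_apply, hg]
    ring
  rw [hsum, ← hgi.condAvg_eq, ← sum_mul_condAvg, condAvg_esPart_eq_zero (Finset.mem_singleton_self i) hiT]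
  simp

/-- **The tree's degree filtration is the Efron–Stein one**: `f^{≤d} = ∑_{|T| ≤ d} f^{=T}`, i.e. the orthogonal
projection onto `V_{≤d}` (span of the cylinder indicators on `≤ d` coordinates) is the sum of the Efron–Stein
parts of size `≤ d`. [cite: KeevashLifshitz2023, §1.4 ("`V_{≤d}` … equivalently the sum of the `V^{=T}`, `|T| ≤ d`")] -/
theorem projLEX_eq_vecX_sum_esPart [Nonempty (Fin m)] (d : ℕ) (h : (Fin N → Fin m) → ℝ) :
    projLEX N m d (vecX h) =
      vecX (fun x => ∑ T ∈ (univ : Finset (Finset (Fin N))).filter (fun T => T.card ≤ d),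
        esPart (α := fun _ : Fin N => Fin m) T h x) := by
  unfold projLEX
  apply Submodule.eq_starProjection_of_mem_of_inner_eq_zero
  · -- each `h^{=T}`, `|T| ≤ d`, is a `T`-junta, hence in `V_{≤d}`
    have : vecX (fun x => ∑ T ∈ (univ : Finset (Finset (Fin N))).filter (fun T => T.card ≤ d),
        esPart (α := fun _ : Fin N => Fin m) T h x) =
        ∑ T ∈ (univ : Finset (Finset (Fin N))).filter (fun T => T.card ≤ d),
          vecX (esPart (α := fun _ : Fin N => Fin m) T h) := by
      ext x; simp
    rw [this]
    refine Submodule.sum_mem _ fun T hT => ?_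
    rw [Finset.mem_filter] at hT
    refine vecX_mem_degLEX_of_junta hT.2 _ fun x x' hxx' => ?_
    exact dependsOff_esPart (α := fun _ : Fin N => Fin m) T h x x' fun i hi => hxx' i (by
      by_contra hiT; exact hi (Finset.mem_sdiff.2 ⟨Finset.mem_univ _, hiT⟩))
  · -- `h - ∑_{|T|≤d} h^{=T} = ∑_{|T|>d} h^{=T}` is orthogonal to every generator
    intro w hw
    have hdiff : vecX h - vecX (fun x => ∑ T ∈ (univ : Finset (Finset (Fin N))).filter (fun T => T.card ≤ d),
        esPart (α := fun _ : Fin N => Fin m) T h x) =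
        ∑ T ∈ (univ : Finset (Finset (Fin N))).filter (fun T => ¬ T.card ≤ d),
          vecX (esPart (α := fun _ : Fin N => Fin m) T h) := by
      ext x
      simp only [vecX_apply, WithLp.ofLp_sub, Pi.sub_apply, WithLp.ofLp_sum, Finset.sum_apply]
      rw [sub_eq_iff_eq_add, add_comm, Finset.sum_filter_add_sum_filter_not, sum_esPart]
    rw [hdiff]
    refine Submodule.span_induction ?_ ?_ ?_ ?_ hw
    · rintro v ⟨S, hS, y, rfl⟩
      rw [sum_inner]
      refine Finset.sum_eq_zero fun T hT => ?_
      rw [Finset.mem_filter] at hT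
      exact inner_vecX_esPart_indX_cylinder (fun hTS => hT.2 ((Finset.card_le_card hTS).trans hS)) h y
    · exact inner_zero_right _
    · intro u v _ _ hu hv; rw [inner_add_right, hu, hv, add_zero]
    · intro c v _ hv; rw [inner_smul_right, hv, mul_zero]

/-- **`levelPartX` is `f^{=d}`**: the tree's degree-`d` part (`f^{≤d} − f^{≤d−1}`) is the Efron–Stein degree-`d`
part `∑_{|T| = d} f^{=T}`. [cite: KeevashLifshitz2023, §1.4 ("`f^{=d} = f^{≤d} − f^{≤d−1}`")] -/
theorem levelPartX_eq_vecX_esLevel [Nonempty (Fin m)] (d : ℕ) (h : (Fin N → Fin m) → ℝ) :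
    levelPartX N m d (vecX h) = vecX (esLevel (α := fun _ : Fin N => Fin m) d h) := by
  unfold levelPartX esLevel
  split_ifs with hd
  · subst hd
    rw [projLEX_eq_vecX_sum_esPart]
    congr 1
    funext x
    exact Finset.sum_congr (by ext T; simp) fun _ _ => rfl
  · rw [projLEX_eq_vecX_sum_esPart, projLEX_eq_vecX_sum_esPart]
    ext x
    simp only [vecX_apply, WithLp.ofLp_sub, Pi.sub_apply]
    rw [sub_eq_iff_eq_add]
    have hsplit : (univ : Finset (Finset (Fin N))).filter (fun T => T.card ≤ d) =
        (univ : Finset (Finset (Fin N))).filter (fun T => T.card = d) ∪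
          (univ : Finset (Finset (Fin N))).filter (fun T => T.card ≤ d - 1) := by
      ext T; simp only [Finset.mem_filter, Finset.mem_univ, true_and, Finset.mem_union]; omega
    rw [hsplit, Finset.sum_union]
    rw [Finset.disjoint_filter]
    intro T _ h1 h2
    omega

end Cube

/-! ## KLM Theorem 5.4 for `[m]^N` in the tree's normalisation, given the hypercontractive estimate -/

/-- **KLM Theorem 5.4 on `[m]^N` = the tree's named fact `KellerLifshitzMarcus2023_thm54`, modulo the
hypercontractive estimate of KLM Thm 4.1** (supplied for every `[m]^N` by
`ProductSpaceHypercontractivity.lean`; with it this theorem becomes `KellerLifshitzMarcus2023_thm54_holds`).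
[cite: KellerLifshitzMarcus2023, Thm. 5.4] -/
theorem klm_thm54_of_hcEstimate
    (h41 : ∀ (N m : ℕ), 0 < m → ∀ (q ρ : ℝ) (g : (Fin N → Fin m) → ℝ), 2 < q → 0 < ρ → ρ ≤ 1 / 3 →
      HcEstimate (α := fun _ : Fin N => Fin m) q ρ g) :
    KellerLifshitzMarcus2023_thm54 := by
  intro N m h r γ₁ γ₂ d hr hγ₁ hγ₁₂ hd hbig
  have hlog : 0 ≤ Real.log (γ₂ / γ₁) := Real.log_nonneg (by rw [le_div_iff₀ hγ₁]; linarith)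
  have hRHS : 0 ≤ γ₁ ^ 2 * (2200 * r ^ 2 * (1 / (d : ℝ)) * Real.log (γ₂ / γ₁)) ^ d := by positivity
  by_cases hm : m = 0
  · subst hm
    by_cases hN : N = 0
    · -- one-point space `[0]^0`: `V_{≤d'}` is everything, so `f^{=d} = 0` for `d ≥ 1` and `f^{=0} = f`
      subst hN
      let x₀ : Fin 0 → Fin 0 := fun i => i.elim0
      have hx : ∀ x : Fin 0 → Fin 0, x = x₀ := fun x => funext fun i => i.elim0
      have hcyl : ∀ x : Fin 0 → Fin 0, x ∈ cylinder (∅ : Finset (Fin 0)) x₀ := fun x => by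
        rw [mem_cylinder]; intro i hi; exact absurd hi (Finset.notMem_empty i)
      have hv : vecX h = h x₀ • indX (cylinder ∅ x₀) := by
        ext x
        rw [hx x]
        simp [hcyl x₀]
      have hmem : ∀ d' : ℕ, vecX h ∈ degLEX 0 0 d' := fun d' => by
        rw [hv]; exact Submodule.smul_mem _ _ (indX_cylinder_mem_degLEX (by simp) x₀)
      have hproj : ∀ d' : ℕ, projLEX 0 0 d' (vecX h) = vecX h := fun d' => projLEX_eq_self (hmem d')
      have h0 : |h x₀| ≤ γ₁ := by
        have := (hbig ∅ (by simp) x₀).1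
        simp only [Finset.card_empty, pow_zero, one_mul, Nat.sub_zero, mul_one] at this
        have hc : cylinder (∅ : Finset (Fin 0)) x₀ = {x₀} := by
          ext x; simp only [Finset.mem_singleton]; exact ⟨fun _ => hx x, fun _ => hcyl x⟩
        rw [hc, Finset.sum_singleton] at this
        exact this
      unfold levelPartX
      split_ifs with hd0
      · subst hd0
        rw [hproj, pow_zero, div_one, pow_zero, mul_one, norm_sq_eq_sum, Fintype.sum_eq_single x₀ (fun x hx' => absurd (hx x) hx')]
        simp only [vecX_apply]
        exact sq_le_sq' (abs_le.1 h0).1 (abs_le.1 h0).2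
      · rw [hproj, hproj, sub_self, norm_zero]
        simpa using hRHS
    · -- empty space: every vector of `L²([0]^N)` is `0`
      haveI : IsEmpty (Fin N → Fin 0) := by
        obtain ⟨n, rfl⟩ := Nat.exists_eq_succ_of_ne_zero hN
        exact ⟨fun x => (x 0).elim0⟩
      have hv : ‖levelPartX N 0 d (vecX h)‖ = 0 := by
        rw [EuclideanSpace.norm_eq]; simp
      rw [hv]
      simpa using hRHS
  · haveI : NeZero m := ⟨hm⟩
    have hm0 : 0 < m := Nat.pos_of_ne_zero hm
    have hmN : (0 : ℝ) < (m : ℝ) ^ N := by positivity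
    have key := l2sq_esLevel_le_of_isRestrGlobal (α := fun _ : Fin N => Fin m)
      (fun q ρ g hq hρ hρ' => h41 N m hm0 q ρ g hq hρ hρ') hr hγ₁ hγ₁₂ hd h (isRestrGlobal_of_isBiglobalX hbig)
    rw [levelPartX_eq_vecX_esLevel, norm_vecX_sq, mul_div_cancel_left₀ _ hmN.ne']
    exact key

end Literature.Combinatorics.Additive.ProductSpace
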